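import Mathlib
import Literature.AlgebraicGeometry.Resolution.CobordantGame
import Literature.AlgebraicGeometry.Resolution.EmbeddedResolutionExcellentSurfaces
import Summits.ResolutionOfSingularities.ResolutionOfSingularities.Theses.WeightedInvariant

/-!
# Sketch-L1-idea-1 — first checkable statements of ideator 1 (technique A: cobordant game rank), slot L/W4.3

[OURS · L1 W4.3] statements only (no proofs); NOT statements of the manuscript under review.  Vocabulary: the registered
game vocabulary `Literature.AlgebraicGeometry.Resolution.CobordantGame` (`cruxChart`, `IsSingular`, `IsMove`, `Won`) of crux
`LocalWeightedDrop` (stmt-8899), which feeds `WeightedConstruction` (stmt-0571) through `GlobalizeLocalDrop` (stmt-14763).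

* §1 ORBIT LEMMA (both cards): the successor `g` at the exceptional point `c` of the move `(θ,w)` satisfies the exact identity
  `g(s, (λ^{wᵢ}(cᵢ+yᵢ) − cᵢ)ᵢ) = λᵃ · g(λ s, y)`, `λ = 1 + μ` — the old `𝔾ₘ` read at `c`.  Consequence: `g` is a
  `p^e`-TWISTED CYLINDER along the orbit curve of `c`, `e = min {v_p(wᵢ) : cᵢ ≠ 0}` (`e = 0` ⟺ tame ⟺ honest cylinder = the landed
  slice theorem p73411; `e ≥ 1` ⟺ totally wild).
* §2 card A `twisted-stratum-saturated-lexmax`: the umbrella tower (pointwise lexmax reproduces, the saturated move wins) and the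
  strengthened game `SaturatedWeightedDrop` (Prover commits to admissible moves whose centre contains every twisted direction).
* §3 card B `orbit-generic-fibre-descent`: a squarefree 4-variable germ with a twisted axis direction is won, conditionally on the
  tree's named fact `CossartJannsenSaito2020Embedded` applied over the imperfect field `k((t))`.
-/

set_option linter.dupNamespace false
set_option autoImplicit false

namespace Summit.ResolutionOfSingularities.ResolutionOfSingularities.Cruxes.WeightedConstruction.IdeasL1I1

open MvPowerSeries
open Literature.AlgebraicGeometry.Resolution

variable {k : Type} [Field k]

/-! ## §1 The orbit lemma -/

/-- Left substitution of the orbit identity on `k[[s, y₁..yₙ]] → k[[s, y₁..yₙ, μ]]` (`μ = X (Fin.last (n+1))`):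
`s ↦ s`, `yᵢ ↦ (1+μ)^{wᵢ} (cᵢ + yᵢ) − cᵢ`. -/
noncomputable def orbitL {n : ℕ} (w : Fin n → ℕ) (c : Fin n → k) : Fin (n + 1) → MvPowerSeries (Fin (n + 2)) k :=
  Matrix.vecCons (X (0 : Fin (n + 2)))
    (fun i : Fin n => (1 + X (Fin.last (n + 1))) ^ (w i) * (C (c i) + X (Fin.castSucc i.succ)) - C (c i))

/-- Right substitution of the orbit identity: `s ↦ (1+μ) s`, `yᵢ ↦ yᵢ`. -/
noncomputable def orbitR {n : ℕ} : Fin (n + 1) → MvPowerSeries (Fin (n + 2)) k :=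
  Matrix.vecCons ((1 + X (Fin.last (n + 1))) * X (0 : Fin (n + 2))) (fun i : Fin n => X (Fin.castSucc i.succ))

/-- A1 = B1 — ORBIT QUASI-INVARIANCE (elementary; quasi-homogeneity bookkeeping of the strict transform on `B`, no inverses of
`λ` needed in the statement).  If `F(chart_c) = sᵃ · g` then `g(s, λ^w(c+y) − c) = λᵃ · g(λ s, y)` with `λ = 1 + μ`. -/
theorem orbit_quasi_invariance {n : ℕ} (F : MvPowerSeries (Fin n) k) (w : Fin n → ℕ) (c : Fin n → k) (a : ℕ)
    (g : MvPowerSeries (Fin (n + 1)) k)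
    (h : subst (CobordantGame.cruxChart k w c) F = X (0 : Fin (n + 1)) ^ a * g) :
    subst (orbitL w c) g = (1 + X (Fin.last (n + 1))) ^ a * subst orbitR g := by
  sorry

/-- TWISTED TRIVIALITY of exponent `p^e` along the formal curve `γ` (through the origin): translating `f` by `γ(σ^{p^e})`
(`σ = X 0` of `Fin (n+1)`) is undone OVER `k[[σ]]` by a `σ`-dependent formal automorphism `Φ` of the `x`-variables and a unit `u`.
`e = 0` is honest (Zariski-)triviality along `γ`; `e ≥ 1` is triviality only after the inseparable base change `σ = t^{1/p^e}`. -/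
def TwistedTrivialAlong (p : ℕ) {n : ℕ} (f : MvPowerSeries (Fin n) k) (γ : Fin n → MvPowerSeries (Fin 1) k) : Prop :=
  (∀ i, constantCoeff (γ i) = 0) ∧
  ∃ (e : ℕ) (Φ : Fin n → MvPowerSeries (Fin (n + 1)) k) (u : MvPowerSeries (Fin (n + 1)) k),
    IsUnit u ∧ (∀ j, constantCoeff (Φ j) = 0) ∧
    IsUnit (Matrix.det (Matrix.of fun i j : Fin n => coeff (Finsupp.single j.succ 1) (Φ i))) ∧
    subst (fun i : Fin n => X i.succ + subst (fun _ : Fin 1 => X (0 : Fin (n + 1)) ^ (p ^ e)) (γ i)) f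
      = u * subst Φ f

/-- The `i`-th coordinate axis as a formal curve direction. -/
noncomputable def axisCurve {n : ℕ} (i : Fin n) : Fin n → MvPowerSeries (Fin 1) k :=
  fun j => if j = i then X (0 : Fin 1) else 0

/-- B2 — WILD SUCCESSORS ARE TWISTED CYLINDERS (from A1 by inverting the diagonal unit scalings over `k[[μ]]` and
re-parametrising `ν = μ^{p^e}`, `k` perfect).  At an AXIS exceptional point `c = c₀ e_{i₀}` the successor is twisted-trivial along
the `y_{i₀}`-axis (the orbit curve of `c`), with exponent `v_p(w_{i₀})`; tame ⟺ exponent `0` ⟺ honest cylinder (p73411). -/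
theorem successor_twistedTrivial_axis (p : ℕ) [Fact p.Prime] [CharP k p] [IsAlgClosed k] {n : ℕ}
    (F : MvPowerSeries (Fin n) k) (w : Fin n → ℕ) (c : Fin n → k) (i₀ : Fin n)
    (hc : ∀ i, i ≠ i₀ → c i = 0) (hc₀ : c i₀ ≠ 0) (hw : 0 < w i₀) (a : ℕ) (g : MvPowerSeries (Fin (n + 1)) k)
    (h : subst (CobordantGame.cruxChart k w c) F = X (0 : Fin (n + 1)) ^ a * g)
    (hg : ¬ (X (0 : Fin (n + 1)) ∣ g)) :
    TwistedTrivialAlong p g (axisCurve i₀.succ) := by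
  sorry

/-! ## §2 Card A: the umbrella tower and the saturated game -/

/-- A0a — REPRODUCTION IS TRANSLATION (the (α)-killer, typed).  Char `p`, `q = p^e ≥ p`: the umbrella `Z^q + x y^q` under the
POINTWISE lexmax move (weights `(q+1, q, q)`, centre the origin) has at the totally wild point `c = (0, γ^q, 0)` the singular
successor `Z^q + (γ^q + x) y^q`, which IS the cylinder over the umbrella after the twist `Z ↦ Z + γ y`. -/
theorem umbrella_reproduces (p e : ℕ) [Fact p.Prime] [CharP k p] (he : 0 < e) (γ : k) (hγ : γ ≠ 0) :
    let q := p ^ e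
    let f : MvPowerSeries (Fin 3) k := X 0 ^ q + X 1 * X 2 ^ q
    let g : MvPowerSeries (Fin 4) k := X 1 ^ q + (C (γ ^ q) + X 2) * X 3 ^ q
    let fcyl : MvPowerSeries (Fin 4) k := X 1 ^ q + X 2 * X 3 ^ q
    subst (CobordantGame.cruxChart k ![q + 1, q, q] ![0, γ ^ q, 0]) f = X (0 : Fin 4) ^ (q * q + q) * g
      ∧ ¬ (X (0 : Fin 4) ∣ g) ∧ CobordantGame.IsSingular k g
      ∧ g = subst (fun i : Fin 4 => if i = 1 then X 1 + C γ * X 3 else X i) fcyl := by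
  sorry

/-- A0b — THE SATURATED MOVE WINS.  For `Z^q + x y^{q m}` (twisted iso-stratum = the `x`-axis) the move with centre `V(Z, y) ⊇`
`x`-axis and weights `(m, 0, 1)` has NO singular successor at all (every exceptional point sees a non-zero constant or the linear
term `c^{qm} x`). -/
theorem umbrella_saturated_wins (q m : ℕ) (hq : 0 < q) (hm : 0 < m) (c : Fin 3 → k)
    (hc : ∃ i, 0 < (![m, 0, 1] : Fin 3 → ℕ) i ∧ c i ≠ 0) (a : ℕ) (g : MvPowerSeries (Fin 4) k)
    (h : subst (CobordantGame.cruxChart k ![m, 0, 1] c) ((X 0 ^ q + X 1 * X 2 ^ (q * m) : MvPowerSeries (Fin 3) k))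
      = X (0 : Fin 4) ^ a * g)
    (hg : ¬ (X (0 : Fin 4) ∣ g)) :
    ¬ CobordantGame.IsSingular k g := by
  sorry

/-- ADMISSIBILITY of the weights `w` with degree `d` for `F` (ATW/AQS: `F` lies in the `d`-th power of the weighted centre):
every monomial of `F` has `w`-weight `≥ d > 0`.  Excludes "pass" moves (blowing up a divisor), which reproduce trivially. -/
def IsAdmissible {n : ℕ} (F : MvPowerSeries (Fin n) k) (w : Fin n → ℕ) (d : ℕ) : Prop :=
  0 < d ∧ ∀ m : Fin n →₀ ℕ, coeff m F ≠ 0 → d ≤ ∑ i, w i * m i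

/-- C⁺ of card A — THE SATURATED GAME.  `LocalWeightedDrop` with the Prover COMMITTED to admissible moves whose centre contains
every twisted axis direction of `f∘θ` (weight `0` on it).  Trivially `SaturatedWeightedDrop → LocalWeightedDrop` (same rank, fewer
moves); the card's rank `ι_A = (ord, κ, plex⊥)` is a candidate witness.  CONJECTURAL. -/
def SaturatedWeightedDrop : Prop :=
  ∀ p : ℕ, p.Prime → ∀ (k : Type) [Field k] [CharP k p] [IsAlgClosed k],
    ∃ ι : (n : ℕ) → MvPowerSeries (Fin n) k → Ordinal.{0},
      ∀ (n : ℕ) (f : MvPowerSeries (Fin n) k), CobordantGame.IsSingular k f →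
        ∃ (θ : Fin n → MvPowerSeries (Fin n) k) (w : Fin n → ℕ) (d : ℕ),
          CobordantGame.IsMove k θ w ∧ IsAdmissible (subst θ f) w d ∧
          (∀ i, TwistedTrivialAlong p (subst θ f) (axisCurve i) → w i = 0) ∧
          ∀ g, CobordantGame.IsSuccessor k f θ w g → ι (n + 1) g < ι n f

/-- The commitment costs nothing logically in one direction. -/
theorem localWeightedDrop_of_saturated (h : SaturatedWeightedDrop) :
    Summit.ResolutionOfSingularities.ResolutionOfSingularities.Theses.WeightedInvariant.LocalWeightedDrop := by
  sorry

/-! ## §3 Card B: generic-fibre descent of wild successors (N = 3, conditional on CJS over imperfect fields) -/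

/-- B3 — A SQUAREFREE 4-VARIABLE GERM WITH A TWISTED AXIS DIRECTION IS WON, given canonical embedded resolution of excellent
surfaces (tree fact `CossartJannsenSaito2020Embedded`, CJS LNM 2270 Thm 1.4) applied to the generic transversal type
`g ⊗ k((t))` — a SURFACE germ over the imperfect excellent field `k((t))` — and spreading its (weight-1, `k[[t]]`-rational,
`𝔾ₘ`-homogeneous hence regular) centres; no second wild event occurs (weights 1 are tame).  With B2 this discharges every
totally wild successor of a surface start without any `ℤ/p`-grading.  CONDITIONAL · bookkeeping-heavy · N = 3 only. -/
theorem won_four_of_twistedAxis_of_CJS (hCJS : CossartJannsenSaito2020Embedded.{0}) :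
    ∀ (p : ℕ), p.Prime → ∀ (k : Type) [Field k] [CharP k p] [IsAlgClosed k] (g : MvPowerSeries (Fin 4) k),
      CobordantGame.IsSingular k g → Squarefree g → (∃ i : Fin 4, TwistedTrivialAlong p g (axisCurve i)) →
      CobordantGame.Won k 4 g := by
  sorry

end Summit.ResolutionOfSingularities.ResolutionOfSingularities.Cruxes.WeightedConstruction.IdeasL1I1
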